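import Summits.QuantumFields.YangMills.Theorems.UnitScaleTiltHistoryTailLowMassCoreInt
import HarnessLib

/-!
# Route `UnitScaleTilt` — crux `HistoryTailL` (stmt-QuantumFields-19936), R-57χ successor line: STUB 4b AT THE INTERIOR DATUM OF A FAMILY OF DATA CORES — the window mass of
# the (47)-minorant, `exp(−CL·x_j·N_j³) ≤ ∫ low_j`, for EVERY odd block size `L > 1` (`HistoryTailLowMassV3`, ym3-torus-p2 g11 / ★18916-p1 g4, re-run with
# `h.dataT3v3 hc γ hγ hγ1 π ↦ dataIntV3 qf π`; the bond ball's radius is `min(1,b₀)g_j/(8·max(B₃,1))`, which costs `CL ↦ CL + 9·log(max(B₃,1))` INSIDE the `∃ CL` —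
# the 4b conclusion TEXT is unchanged; negation-lens pre-check N-g24-2) — seat ym3-torus-p2 (g16)

`integral_low_ge`: integrate `HistoryTailLowMassInt.low_ge_on_ball` over the bond ball (product-Haar mass `≥ (c·r³)^{3N³}`, `r = min(1,b₀)·g_j/(8·max(B₃,1))`).
`lowMass_int_of_one_lt`: the registered 4b text over the core family, the [Balaban1985Variational] constant read off the family (`hq : ∀ K, (qf K).a₁ = a₁`, so that
`ε₁ := min(1,b₀)g_i ≤ a₁` is ONE γ-threshold `γ ≤ a₁²`).  Nothing of [Balaban1985UV3] is asserted; CONDITIONAL only on the family `qf`.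
[cite: Balaban1985UV3, (47) p.267 and (5) p.256; Balaban1985Variational, Thm 1 (8) p.279]
-/

noncomputable section

namespace Summit.QuantumFields.YangMills.Theorems.HistoryTailLowMassInt

open Summit.QuantumFields.YangMills.Theorems.HistoryTailLowMass
  (haar_real_ball_ge card_plaq_T3 card_pbond_T3 sitesPerDir_zero_eq_mul wilsonAction4_le_of_plaqSmall mul_coupling_le_θBal scheme_β_eq_pow_div)

open MeasureTheory
open scoped Matrix.Norms.L2Operator
open Literature.MathematicalPhysics.QuantumFieldTheory (haarProbability)
open Literature.MathematicalPhysics.QuantumFieldTheory.Balaban1983to89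
open Literature.MathematicalPhysics.QuantumFieldTheory.Balaban1983to89.T3ContinuumYM3Torus
open Literature.MathematicalPhysics.QuantumFieldTheory.Balaban1983to89.T3UnitLawDensityEML (ℰp)
open Literature.MathematicalPhysics.QuantumFieldTheory.Balaban1983to89.T3UnitScaleTilt (θBal)
open Literature.MathematicalPhysics.QuantumFieldTheory.Balaban1983to89.T3LevelShift (fieldShift fieldShift_symm_fieldShift)
open Literature.MathematicalPhysics.QuantumFieldTheory.Balaban1983to89.T3PrintedRegularMinimiser (regFibrePr mem_regFibrePr_iff)
open Literature.MathematicalPhysics.QuantumFieldTheory.Balaban1983to89.T3RegularMinimiser (regThreshold)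
open Literature.MathematicalPhysics.QuantumFieldTheory.Balaban1983to89.T3AlphaInputsAC
open Literature.MathematicalPhysics.QuantumFieldTheory.Balaban1983to89.T4StabilityFloor (bondBall mem_bondBall
  fieldMeasure_real_bondBall measurableSet_bondBall card_pbond card_plaq)
open Summit.QuantumFields.Balaban3D.Carriers (suGroupModel Hist)
open Summit.QuantumFields.Balaban3D.Proofs.Primitives (AlphaConsts)

/-! ## §1 The window mass of the minorant at one level, given the main-term bound -/

section Assembly

variable {F : T3Family} {𝔠 : AlphaConsts F.L (suGroupModel 2).N} {γ : ℝ} {hγ : 0 < γ} {hγ1 : γ ≤ (min 𝔠.gamma0 1) ^ 2}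
  (qf : ∀ K, AlphaInputsT3AC.PkgCoreV3 F 𝔠 γ hγ hγ1 K) (π : AlphaInputsT3AC.PolymerT3 F)

/-- **THE WINDOW MASS OF THE MINORANT** at level `k ≤ K`, given the main-term bound on `min(1,b₀)g_k`-small fields: integrate the pointwise
bound `low_ge_on_ball` over the bond ball, whose product-Haar mass is `haar{|g−1| ≤ r}^{3N³} ≥ (c·r³)^{3N³}`, `r = min(1,b₀)·g_k/(8·max(B₃,1))`.
[cite: Balaban1985UV3, (47) p.267 and Thm 1 (5) p.256] -/
theorem integral_low_ge {CP : ℝ} (hCP : 0 ≤ CP) (hPS : PintSize (AlphaInputsT3AC.dataIntV3 qf π) 𝔠.b₀ 𝔠.p₀ CP)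
    (hθ1 : ∀ i, θBal F.L γ 𝔠.b₀ 𝔠.p₀ i ≤ 1) (hγ1' : γ ≤ 1) {c : ℝ} (hc0 : 0 < c) (hc1 : c ≤ 1)
    (hball : ∀ r : ℝ, 0 < r → r ≤ 1 →
      c * r ^ 3 ≤ (HaarData.haar (G := Matrix.specialUnitaryGroup (Fin 2) ℂ)).real
        {g : Matrix.specialUnitaryGroup (Fin 2) ℂ | dist1 g ≤ r})
    (K k : ℕ) (hk : k ≤ K)
    (hmain : ∀ W : GaugeField (F.P K) k (Matrix.specialUnitaryGroup (Fin 2) ℂ),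
      PlaqSmall (min 1 𝔠.b₀ * Real.sqrt (γ * ((F.L : ℝ)⁻¹) ^ (K - k))) W →
        (F.scheme ℰp γ).β K *
            wilsonAction4 ((AlphaInputsT3AC.dataIntV3 qf π).Umin K k ((AlphaInputsT3AC.dataIntV3 qf π).triv K k) W) ≤
          (2 * 𝔠.B₃ ^ 2 + 2) * ((F.P K).sitesPerDir k : ℝ) ^ 3) :
    Real.exp (-((2 * 𝔠.B₃ ^ 2 + 2 + CP + 3 * Real.log c⁻¹ + 9 * (1 + Real.log (8 * max 𝔠.B₃ 1 / min 1 𝔠.b₀))) *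
        (1 + Real.log (Real.sqrt (γ * ((F.L : ℝ)⁻¹) ^ (K - k)))⁻¹) * ((F.P K).sitesPerDir k : ℝ) ^ 3)) ≤
      ∫ W, (AlphaInputsT3AC.dataIntV3 qf π).low K k W ∂fieldMeasure (F.P K) k (Matrix.specialUnitaryGroup (Fin 2) ℂ) := by
  set g : ℝ := Real.sqrt (γ * ((F.L : ℝ)⁻¹) ^ (K - k)) with hg
  set t : ℝ := min 1 𝔠.b₀ with ht
  set N : ℝ := ((F.P K).sitesPerDir k : ℝ) with hN
  set x : ℝ := 1 + Real.log g⁻¹ with hx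
  set Mx : ℝ := max 𝔠.B₃ 1 with hMx
  have hMx1 : 1 ≤ Mx := le_max_right _ _
  have hMx0 : 0 < Mx := lt_of_lt_of_le one_pos hMx1
  set r : ℝ := t * g / (8 * Mx) with hr
  set μ := fieldMeasure (F.P K) k (Matrix.specialUnitaryGroup (Fin 2) ℂ) with hμ
  have hL1 : 1 ≤ F.L := F.hL.2.le
  have hg0 : 0 < g := (T3ThresholdSmallness.sqrt_coupling_pos_le hL1 hγ (K - k)).1
  have hg1 : g ≤ 1 := T3Thresholds.coupling_le_one hL1 hγ hγ1' (K - k)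
  have ht0 : 0 < t := lt_min one_pos 𝔠.b₀_pos
  have ht1 : t ≤ 1 := min_le_left _ _
  have hε0 : 0 < t * g := mul_pos ht0 hg0
  have hε1 : t * g ≤ 1 := by nlinarith
  have hr0 : 0 < r := by rw [hr]; positivity
  have hr1 : r ≤ 1 := by
    rw [hr, div_le_one (by positivity)]
    nlinarith
  have hx1 : 1 ≤ x := by
    have : 0 ≤ Real.log g⁻¹ := Real.log_nonneg (one_le_inv_iff₀.mpr ⟨hg0, hg1⟩)
    rw [hx]; linarith
  have hN1 : 1 ≤ N := by
    rw [hN]; exact_mod_cast Nat.one_le_iff_ne_zero.mpr ((F.P K).sitesPerDir_ne_zero k)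
  have hN0 : 0 ≤ N := zero_le_one.trans hN1
  have hN3 : 0 ≤ N ^ 3 := pow_nonneg hN0 3
  -- the ball
  set B : Set (Matrix.specialUnitaryGroup (Fin 2) ℂ) := {g' | dist1 g' ≤ r} with hB
  have hBm : MeasurableSet B := measurableSet_le RegularGaugeGroup.measurable_dist1 measurable_const
  set ball := bondBall (F.P K) k B with hball_def
  have hballm : MeasurableSet ball := measurableSet_bondBall hBm
  set M : ℝ := (2 * 𝔠.B₃ ^ 2 + 2 + CP) * N ^ 3 with hM
  -- pointwise: the indicator of the ball times `e^{−M}` is below `low`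
  have hpt : ∀ W, ball.indicator (fun _ => Real.exp (-M)) W ≤ (AlphaInputsT3AC.dataIntV3 qf π).low K k W := by
    intro W
    by_cases hW : W ∈ ball
    · rw [Set.indicator_of_mem hW]
      exact low_ge_on_ball qf π hCP hPS hθ1 hγ1' K k hk hmain W (fun b => (mem_bondBall.mp hW) b)
    · rw [Set.indicator_of_notMem hW]
      exact low_nonneg (AlphaInputsT3AC.dataIntV3_chiRange qf π) K k W
  have hint_ind : Integrable (ball.indicator fun _ => Real.exp (-M)) μ := (integrable_const _).indicator hballm
  have hint_low : Integrable ((AlphaInputsT3AC.dataIntV3 qf π).low K k) μ := AlphaInputsT3AC.dataIntV3_integrable_low qf π K k hk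
  have hI : Real.exp (-M) * μ.real ball ≤ ∫ W, (AlphaInputsT3AC.dataIntV3 qf π).low K k W ∂μ := by
    have h1 : ∫ W, ball.indicator (fun _ => Real.exp (-M)) W ∂μ = Real.exp (-M) * μ.real ball := by
      rw [integral_indicator hballm, setIntegral_const, smul_eq_mul, mul_comm]
    rw [← h1]
    exact integral_mono hint_ind hint_low hpt
  -- the ball's mass
  have hcr : 0 < c * r ^ 3 := by positivity
  have hmass : (c * r ^ 3) ^ (3 * (F.P K).sitesPerDir k ^ 3) ≤ μ.real ball := by
    rw [hμ, hball_def, fieldMeasure_real_bondBall, card_pbond_T3]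
    exact pow_le_pow_left₀ hcr.le (hball r hr0 hr1) _
  have hpow : (c * r ^ 3) ^ (3 * (F.P K).sitesPerDir k ^ 3) = Real.exp (3 * N ^ 3 * Real.log (c * r ^ 3)) := by
    rw [← Real.exp_log (pow_pos hcr (3 * (F.P K).sitesPerDir k ^ 3)), Real.log_pow]
    congr 1
    rw [hN]; push_cast; ring
  have hlogr : Real.log r = -Real.log (8 * Mx / t) - (x - 1) := by
    rw [hr, hx, Real.log_div hε0.ne' (by positivity), Real.log_mul ht0.ne' hg0.ne', Real.log_div (by positivity) ht0.ne',
      Real.log_inv]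
    ring
  have hlogcr : Real.log (c * r ^ 3) = -Real.log c⁻¹ - 3 * Real.log (8 * Mx / t) - 3 * (x - 1) := by
    rw [Real.log_mul hc0.ne' (pow_pos hr0 3).ne', Real.log_pow, Real.log_inv, hlogr]
    push_cast
    ring
  -- the exponent bookkeeping
  have hlc : 0 ≤ Real.log c⁻¹ := Real.log_nonneg (one_le_inv_iff₀.mpr ⟨hc0, hc1⟩)
  have hlt : 0 ≤ Real.log (8 * Mx / t) := by
    refine Real.log_nonneg ?_
    rw [le_div_iff₀ ht0]
    nlinarith
  have hA0 : 0 ≤ 2 * 𝔠.B₃ ^ 2 + 2 + CP := by positivity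
  have hxN : N ^ 3 ≤ x * N ^ 3 := le_mul_of_one_le_left hN3 hx1
  have e1 : (2 * 𝔠.B₃ ^ 2 + 2 + CP) * N ^ 3 ≤ (2 * 𝔠.B₃ ^ 2 + 2 + CP) * (x * N ^ 3) := mul_le_mul_of_nonneg_left hxN hA0
  have e2 : Real.log c⁻¹ * N ^ 3 ≤ Real.log c⁻¹ * (x * N ^ 3) := mul_le_mul_of_nonneg_left hxN hlc
  have e3 : Real.log (8 * Mx / t) * N ^ 3 ≤ Real.log (8 * Mx / t) * (x * N ^ 3) := mul_le_mul_of_nonneg_left hxN hlt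
  have hexp : Real.exp (-((2 * 𝔠.B₃ ^ 2 + 2 + CP + 3 * Real.log c⁻¹ + 9 * (1 + Real.log (8 * Mx / t))) * x * N ^ 3)) ≤
      Real.exp (-M) * (c * r ^ 3) ^ (3 * (F.P K).sitesPerDir k ^ 3) := by
    rw [hpow, ← Real.exp_add, hlogcr, hM]
    exact Real.exp_le_exp.mpr (by nlinarith)
  calc Real.exp (-((2 * 𝔠.B₃ ^ 2 + 2 + CP + 3 * Real.log c⁻¹ + 9 * (1 + Real.log (8 * Mx / t))) * x * N ^ 3))
      ≤ Real.exp (-M) * (c * r ^ 3) ^ (3 * (F.P K).sitesPerDir k ^ 3) := hexp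
    _ ≤ Real.exp (-M) * μ.real ball := mul_le_mul_of_nonneg_left hmass (Real.exp_nonneg _)
    _ ≤ ∫ W, (AlphaInputsT3AC.dataIntV3 qf π).low K k W ∂μ := hI

end Assembly

/-! ## §2 4b for every admissible block size, over the core family -/

/-- **4b FOR EVERY ODD BLOCK SIZE `L > 1`, AT THE INTERIOR DATUM OF A FAMILY OF DATA CORES** — the registered `stub_lowMass` conclusion text (`∃ CL γb, … exp(−CL·x_j·N_j³) ≤ ∫ low_j`)
with `OfV3At`/`dataT3v3` replaced by a core family `qf` whose [Balaban1985Variational] constant `a₁` is the given one (`hq`); `CL` absorbs `9·log(max(B₃,1))` for the interior radius.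
[cite: Balaban1985UV3, (47) p.267 and (5) p.256; Balaban1985Variational, Thm 1 (8) p.279] -/
theorem lowMass_int_of_one_lt :
    ∀ (L : ℕ), Odd L → 1 < L →
      ∀ (𝔠 : AlphaConsts L (suGroupModel 2).N) (a₁ : ℝ), 0 < a₁ →
        ∀ (CP : ℝ), 0 ≤ CP → ∃ (CL γb : ℝ), 0 ≤ CL ∧ 0 < γb ∧
          ∀ (F : T3Family) (hF : F.L = L) (γ : ℝ) (hγ : 0 < γ) (hγ1 : γ ≤ (min (hF ▸ 𝔠).gamma0 1) ^ 2)
            (qf : ∀ K, AlphaInputsT3AC.PkgCoreV3 F (hF ▸ 𝔠) γ hγ hγ1 K) (π : AlphaInputsT3AC.PolymerT3 F), (∀ K, (qf K).a₁ = a₁) → γ ≤ γb →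
            PintSize (AlphaInputsT3AC.dataIntV3 qf π) (hF ▸ 𝔠).b₀ (hF ▸ 𝔠).p₀ CP →
            ∀ (K j : ℕ), j ≤ K →
              Real.exp (-(CL * (1 + Real.log (Real.sqrt (γ * ((F.L : ℝ)⁻¹) ^ (K - j)))⁻¹) * ((F.P K).sitesPerDir j : ℝ) ^ 3)) ≤
                ∫ Wf, (AlphaInputsT3AC.dataIntV3 qf π).low K j Wf ∂fieldMeasure (F.P K) j (Matrix.specialUnitaryGroup (Fin 2) ℂ) := by
  intro L hLo hL1' 𝔠 a₁ ha1 CP hCP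
  obtain ⟨c, hc0, hc1, hball⟩ := haar_real_ball_ge
  obtain ⟨γθ, hγθ, hγθ1, hθle⟩ := T3Thresholds.exists_gamma_forall_θBal_le 𝔠.b₀_pos 𝔠.p₀_pos one_pos
  have hlc : 0 ≤ Real.log c⁻¹ := Real.log_nonneg (one_le_inv_iff₀.mpr ⟨hc0, hc1⟩)
  have ht0 : 0 < min 1 𝔠.b₀ := lt_min one_pos 𝔠.b₀_pos
  have hMx1 : 1 ≤ max 𝔠.B₃ 1 := le_max_right _ _
  have hlt : 0 ≤ Real.log (8 * max 𝔠.B₃ 1 / min 1 𝔠.b₀) := by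
    refine Real.log_nonneg ?_
    rw [le_div_iff₀ ht0]
    nlinarith [min_le_left (1 : ℝ) 𝔠.b₀]
  refine ⟨2 * 𝔠.B₃ ^ 2 + 2 + CP + 3 * Real.log c⁻¹ + 9 * (1 + Real.log (8 * max 𝔠.B₃ 1 / min 1 𝔠.b₀)), min γθ (a₁ ^ 2),
    by positivity, lt_min hγθ (by positivity), ?_⟩
  intro F hF γ hγ hγ1 qf π hq hγb hPS K j hjK
  subst hF
  have hγθ' : γ ≤ γθ := hγb.trans (min_le_left _ _)
  have hγa : γ ≤ a₁ ^ 2 := hγb.trans (min_le_right _ _)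
  have hγ1' : γ ≤ 1 := hγθ'.trans hγθ1
  have hL1 : 1 ≤ F.L := F.hL.2.le
  have hθ1 : ∀ i, θBal F.L γ 𝔠.b₀ 𝔠.p₀ i ≤ 1 := fun i => hθle F.L hL1 γ hγ hγθ' i
  -- `ε₁ := min(1,b₀)·g_i` is positive, `≤ a₁ = (qf K).a₁`, and `ε₁² ≤ g_i²`
  have hsmall : ∀ i : ℕ, 0 < min 1 𝔠.b₀ * Real.sqrt (γ * ((F.L : ℝ)⁻¹) ^ i) ∧
      min 1 𝔠.b₀ * Real.sqrt (γ * ((F.L : ℝ)⁻¹) ^ i) ≤ (qf K).a₁ ∧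
      (min 1 𝔠.b₀ * Real.sqrt (γ * ((F.L : ℝ)⁻¹) ^ i)) ^ 2 ≤ γ * ((F.L : ℝ)⁻¹) ^ i := by
    intro i
    obtain ⟨hg0, hgle⟩ := T3ThresholdSmallness.sqrt_coupling_pos_le hL1 hγ i
    have hεg : min 1 𝔠.b₀ * Real.sqrt (γ * ((F.L : ℝ)⁻¹) ^ i) ≤ Real.sqrt (γ * ((F.L : ℝ)⁻¹) ^ i) :=
      mul_le_of_le_one_left hg0.le (min_le_left _ _)
    have hga : Real.sqrt γ ≤ a₁ := by
      rw [← Real.sqrt_sq ha1.le]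
      exact Real.sqrt_le_sqrt hγa
    refine ⟨mul_pos ht0 hg0, (hq K).symm ▸ hεg.trans (hgle.trans hga), ?_⟩
    have h2 := pow_le_pow_left₀ (mul_pos ht0 hg0).le hεg 2
    rwa [Real.sq_sqrt (by positivity)] at h2
  rcases Nat.eq_zero_or_pos j with hj0 | hjpos
  · subst hj0
    exact integral_low_ge qf π hCP hPS hθ1 hγ1' hc0 hc1 hball K 0 (Nat.zero_le K)
      (fun W hW => mainT_le_of_small_zero qf π K (hsmall (K - 0)).2.2 W hW)
  · have hA : ∀ W : GaugeField (F.P K) (K - (K - j)) (Matrix.specialUnitaryGroup (Fin 2) ℂ),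
        PlaqSmall (min 1 𝔠.b₀ * Real.sqrt (γ * ((F.L : ℝ)⁻¹) ^ (K - j))) W →
          (F.scheme ℰp γ).β K *
              wilsonAction4 ((AlphaInputsT3AC.dataIntV3 qf π).Umin K (K - (K - j))
                ((AlphaInputsT3AC.dataIntV3 qf π).triv K (K - (K - j))) W) ≤
            (2 * 𝔠.B₃ ^ 2 + 2) * ((F.P K).sitesPerDir (K - (K - j)) : ℝ) ^ 3 :=
      fun W hW => mainT_le_of_small_pos qf π K (K - j) (by omega) (hsmall (K - j)).1 (hsmall (K - j)).2.1
        (hsmall (K - j)).2.2 W hW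
    rw [Nat.sub_sub_self hjK] at hA
    exact integral_low_ge qf π hCP hPS hθ1 hγ1' hc0 hc1 hball K j hjK hA

end Summit.QuantumFields.YangMills.Theorems.HistoryTailLowMassInt

end
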